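import Summits.Ventures.Crystal3D.Theorems.StickyWulffConstantTextureBuildMeshV5
import HarnessLib

/-!
# TB-D assembly, part 17: the DESIGNATED FACETS of a v5 mesh as one finite family of planar regions, and their total area
# (lane T, crux `TextureLiminfV5`, stmt-Ventures-23912; blueprint HOME/wulff-p2/g20/TB-D-2-g20.md §2, stub `stub_desArea` of TexShadowTB.lean)

HONEST FRAMING. Venture `Summits/Ventures/Crystal3D` (cell `crystal3d-full`), route `route-Ventures-StickyWulffConstant`, helper `--supports` the
law-v5 crux `TextureLiminfV5` (stmt-Ventures-23912).  Two small DEFINITIONS + finite-sum bookkeeping (census-free, standard axioms); F-C1 not moved.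

The ledger splitting (`free_le_split` / `wall_le_split`) takes the designated regions as ONE finite family `Φ d ⊆ {⟪nrm d, x⟫ = lvl d}`.  For a v5 mesh these
are the designated facets of territories (`desD`), gap pieces (`desQ`), riser boxes (`desB`) and the prism laterals (`latP`), packaged as pairs
`d = (H-set of the polytope, half-space datum)` with region `facetOf d.1 d.2`, normal `d.2.1`, level `d.2.2`:
* `Mesh₅.desSet`, `Mesh₅.desSet_spec` (the datum belongs to a bounded mesh polytope with unit normals), `Mesh₅.desRegion_spec` (planar, closed, bounded);
* `Mesh₅.desArea := Σ_{d ∈ desSet} facetArea (facetOf d.1 d.2) d.2.1`, `desArea_nonneg`, and **`Mesh₅.desArea_le : desArea ≤ gapArea + Σ_k latArea k`**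
  (`hgapArea`, `hlatArea`; sums over unions / `biUnion`s / injective images of nonnegative terms).
-/

noncomputable section

open scoped BigOperators InnerProductSpace

namespace Summit.Ventures.Crystal3D.Cruxes.TextureLiminf.TexShadow

open Summit.Ventures.Crystal3D Summit.Ventures.Crystal3D.Theorems MeasureTheory Set

/-! ### Finite-sum bookkeeping -/

/-- Union bound for sums of nonnegative terms. -/
private theorem sum_union_le_of_nonneg {α : Type*} [DecidableEq α] (A B : Finset α) (f : α → ℝ) (hf : ∀ a, 0 ≤ f a) :
    ∑ a ∈ A ∪ B, f a ≤ ∑ a ∈ A, f a + ∑ a ∈ B, f a := by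
  rw [← Finset.union_sdiff_self_eq_union, Finset.sum_union Finset.disjoint_sdiff]
  have h : ∑ a ∈ B \ A, f a ≤ ∑ a ∈ B, f a := Finset.sum_le_sum_of_subset_of_nonneg Finset.sdiff_subset fun a _ _ => hf a
  linarith

/-- `biUnion` bound for sums of nonnegative terms. -/
private theorem sum_biUnion_le_of_nonneg {ι α : Type*} [DecidableEq α] (s : Finset ι) (t : ι → Finset α) (f : α → ℝ) (hf : ∀ a, 0 ≤ f a) :
    ∑ a ∈ s.biUnion t, f a ≤ ∑ i ∈ s, ∑ a ∈ t i, f a := by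
  classical
  induction s using Finset.induction_on with
  | empty => simp
  | @insert i s hi ih =>
    rw [Finset.biUnion_insert, Finset.sum_insert hi]
    exact (sum_union_le_of_nonneg _ _ f hf).trans (by linarith)

namespace Mesh₅

variable {C R₀ : ℝ} {N : ℕ} {x : Fin N → E3} {rc : RiseredCover C R₀ N x} {δ : ℝ} (μ : Mesh₅ rc δ)

/-- the designated facets, as pairs (H-set of the polytope, half-space datum): territories, gap pieces, boxes, prism laterals -/
def desSet : Finset (Finset (E3 × ℝ) × (E3 × ℝ)) :=
  (Finset.univ.biUnion fun f => Finset.univ.biUnion fun j => (μ.desD f j).image fun p => (μ.HD f j, p)) ∪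
  (Finset.univ.biUnion fun l => (μ.desQ l).image fun p => (μ.HQ l, p)) ∪
  (Finset.univ.biUnion fun r => (μ.desB r).image fun p => (μ.HB r, p)) ∪
  (Finset.univ.biUnion fun k => (μ.latP k).image fun p => (μ.HP k, p))

/-- Designated facets: the datum belongs to the polytope, which is one of the bounded mesh polytopes with unit normals. -/
theorem desSet_spec {d : Finset (E3 × ℝ) × (E3 × ℝ)} (hd : d ∈ μ.desSet) :
    d.2 ∈ d.1 ∧ Bornology.IsBounded (polytope d.1) ∧ ‖d.2.1‖ = 1 := by
  simp only [desSet, Finset.mem_union, Finset.mem_biUnion, Finset.mem_univ, true_and, Finset.mem_image] at hd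
  rcases hd with ((⟨f, j, p, hp, rfl⟩ | ⟨l, p, hp, rfl⟩) | ⟨r, p, hp, rfl⟩) | ⟨k, p, hp, rfl⟩
  · exact ⟨μ.hdesD f j hp, μ.hDbd f j, μ.hDunit f j p (μ.hdesD f j hp)⟩
  · exact ⟨μ.hdesQ l hp, μ.hQbd l, μ.hQunit l p (μ.hdesQ l hp)⟩
  · exact ⟨μ.hdesB r hp, μ.hBbd r, μ.hBunit r p (μ.hdesB r hp)⟩
  · exact ⟨μ.hlatP k hp, μ.hPbd k, μ.hPunit k p (μ.hlatP k hp)⟩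

/-- Designated regions (`facetOf d.1 d.2`) are planar, closed and bounded. -/
theorem desRegion_spec {d : Finset (E3 × ℝ) × (E3 × ℝ)} (hd : d ∈ μ.desSet) :
    facetOf d.1 d.2 ⊆ {y : E3 | ⟪d.2.1, y⟫_ℝ = d.2.2} ∧ IsClosed (facetOf d.1 d.2) ∧ Bornology.IsBounded (facetOf d.1 d.2) := by
  refine ⟨fun y hy => hy.2, isClosed_closure.inter (isClosed_eq (continuous_const.inner continuous_id) continuous_const), ?_⟩
  exact (μ.desSet_spec hd).2.1.closure.subset (fun y hy => hy.1)

/-- total designated area -/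
def desArea : ℝ := ∑ d ∈ μ.desSet, facetArea (facetOf d.1 d.2) d.2.1

/-- The designated area is nonnegative. -/
theorem desArea_nonneg : 0 ≤ μ.desArea := Finset.sum_nonneg fun _ _ => ENNReal.toReal_nonneg

/-- **The designated area is within the mesh's budgets**: `desArea ≤ gapArea + Σ_k latArea k`. -/
theorem desArea_le : μ.desArea ≤ μ.gapArea + ∑ k, μ.latArea k := by
  classical
  set g : Finset (E3 × ℝ) × (E3 × ℝ) → ℝ := fun d => facetArea (facetOf d.1 d.2) d.2.1 with hg
  have hg0 : ∀ d, 0 ≤ g d := fun _ => ENNReal.toReal_nonneg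
  -- images are injective in the datum
  have himg : ∀ (G : Finset (E3 × ℝ)) (S : Finset (E3 × ℝ)), ∑ d ∈ S.image (fun p => (G, p)), g d = ∑ p ∈ S, facetArea (facetOf G p) p.1 := by
    intro G S
    rw [Finset.sum_image (fun p _ p' _ h => (Prod.mk.inj h).2)]
  have hA : ∑ d ∈ Finset.univ.biUnion (fun f => Finset.univ.biUnion fun j => (μ.desD f j).image fun p => (μ.HD f j, p)), g d ≤
      ∑ f, ∑ j, ∑ p ∈ μ.desD f j, facetArea (facetOf (μ.HD f j) p) p.1 := by
    refine (sum_biUnion_le_of_nonneg _ _ g hg0).trans (Finset.sum_le_sum fun f _ => ?_)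
    refine (sum_biUnion_le_of_nonneg _ _ g hg0).trans (Finset.sum_le_sum fun j _ => ?_)
    rw [himg]
  have hB : ∑ d ∈ Finset.univ.biUnion (fun l => (μ.desQ l).image fun p => (μ.HQ l, p)), g d ≤ ∑ l, ∑ p ∈ μ.desQ l, facetArea (facetOf (μ.HQ l) p) p.1 := by
    refine (sum_biUnion_le_of_nonneg _ _ g hg0).trans (Finset.sum_le_sum fun l _ => ?_)
    rw [himg]
  have hC : ∑ d ∈ Finset.univ.biUnion (fun r => (μ.desB r).image fun p => (μ.HB r, p)), g d ≤ ∑ r, ∑ p ∈ μ.desB r, facetArea (facetOf (μ.HB r) p) p.1 := by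
    refine (sum_biUnion_le_of_nonneg _ _ g hg0).trans (Finset.sum_le_sum fun r _ => ?_)
    rw [himg]
  have hD : ∑ d ∈ Finset.univ.biUnion (fun k => (μ.latP k).image fun p => (μ.HP k, p)), g d ≤ ∑ k, μ.latArea k := by
    refine (sum_biUnion_le_of_nonneg _ _ g hg0).trans (Finset.sum_le_sum fun k _ => ?_)
    rw [himg]; exact μ.hlatArea k
  have hgap := μ.hgapArea
  unfold desArea desSet
  calc ∑ d ∈ ((Finset.univ.biUnion (fun f => Finset.univ.biUnion fun j => (μ.desD f j).image fun p => (μ.HD f j, p)) ∪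
          Finset.univ.biUnion (fun l => (μ.desQ l).image fun p => (μ.HQ l, p))) ∪
          Finset.univ.biUnion (fun r => (μ.desB r).image fun p => (μ.HB r, p))) ∪
          Finset.univ.biUnion (fun k => (μ.latP k).image fun p => (μ.HP k, p)), g d
      ≤ ((∑ d ∈ Finset.univ.biUnion (fun f => Finset.univ.biUnion fun j => (μ.desD f j).image fun p => (μ.HD f j, p)), g d) +
          ∑ d ∈ Finset.univ.biUnion (fun l => (μ.desQ l).image fun p => (μ.HQ l, p)), g d) +
          (∑ d ∈ Finset.univ.biUnion (fun r => (μ.desB r).image fun p => (μ.HB r, p)), g d) +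
          ∑ d ∈ Finset.univ.biUnion (fun k => (μ.latP k).image fun p => (μ.HP k, p)), g d := by
        refine (sum_union_le_of_nonneg _ _ g hg0).trans ?_
        refine add_le_add ((sum_union_le_of_nonneg _ _ g hg0).trans (add_le_add ((sum_union_le_of_nonneg _ _ g hg0)) le_rfl)) le_rfl
    _ ≤ μ.gapArea + ∑ k, μ.latArea k := by linarith

end Mesh₅

end Summit.Ventures.Crystal3D.Cruxes.TextureLiminf.TexShadow

end
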